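import Mathlib.FieldTheory.AlgebraicClosure
import Summits.KontsevichZagierPeriods.KontsevichZagierPeriods.Theorems.HurwitzMicroSectorsNormalFormPrincipleSplitMoves
import Summits.KontsevichZagierPeriods.KontsevichZagierPeriods.Theorems.HurwitzMicroSectorsNormalFormPrincipleSplitAlgebra
import Summits.KontsevichZagierPeriods.KontsevichZagierPeriods.Theorems.HurwitzMicroSectorsNormalFormPrincipleAlgDlogMoves

/-!
# `NormalFormPrinciple` (stmt-KontsevichZagierPeriods-3869), stub `box_algsplit_mem_relations`
# (siege k5, Mathlib API route), III: the kit over the field `K = algebraicClosure ℚ ℝ`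

Pure proof file (`--supports` the crux stmt-KontsevichZagierPeriods-3869). The algebra of the
algebraic-pole layer is done inside Mathlib's relative algebraic closure
`K := algebraicClosure ℚ ℝ` (the real algebraic numbers, an `IntermediateField ℚ ℝ`), so that every
coefficient produced by partial fractions is algebraic by construction; polynomials `P : K[X]` are
evaluated at real points through `Polynomial.aeval` along `Algebra K ℝ`. Contents:

* `K`-rational functions `t ↦ P(t)/Q(t)` read on the first coordinate are `ℚ`-semialgebraic
  (`isSemialgebraicFunOn_aevalK_div`), and `[(0,1), P/Q]` exists (`exists_repK_unit`);
* one peeling step of the partial-fraction expansion over `K` (`peel_pole_algClosure`) and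
  polynomial primitives over `K` (`exists_polynomial_hasDerivAtK`);
* the **Newton–Leibniz move over the point** with an abstract semialgebraic primitive on `[0,1]`
  (`unit_slab_sub_pt_mem_relations`, registered sub-goal): `[(0,1), F'] ≡ [pt, F(1) − F(0)]`;
* the affine move with real algebraic coefficients (`affineA_sub_mem_relations`) and its two
  instances carrying a simple pole `[(0,1), c/(x − ρ)]` (`ρ < 0`, resp. `ρ > 1`) to a carrier
  `[(1, u), ±c/y]` with `u = 1 − 1/ρ`, resp. `u = ρ/(ρ − 1)` (`pole_neg_sub_carrier_mem_relations`,
  `pole_pos_sub_carrier_mem_relations`).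

Sources: M. Kontsevich, D. Zagier, *Periods* (2001), §1.2 rules (1)–(3); J. Bochnak, M. Coste,
M.-F. Roy, *Real Algebraic Geometry* (1998), §2.2. No definitions are introduced.
-/

noncomputable section

open MeasureTheory Set Finset
open scoped Polynomial
open Literature.NumberTheory.Transcendental Literature.NumberTheory.Transcendental.KZ
open Literature.ModelTheory.ExponentialFields (IsSemialgebraic isSemialgebraic_univ)

namespace Summit.KontsevichZagierPeriods.HurwitzMicroSectors.NormalFormPrinciple.PiBox

namespace AlgSplitK5

open Dlog
open Literature.NumberTheory.Transcendental.KZ.BallPeeling (isSemialgebraic_Ioo₁)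
open Summit.KontsevichZagierPeriods.KontsevichZagierPeriods.BetaCancellationLine
  (aff_hasFDerivAt_chart aff_injective_chart aff_isSemialgebraicMapOn_chart)
open Summit.KontsevichZagierPeriods.HurwitzMicroSectors.NormalFormPrinciple.Negative
  (setIntegral_fin_one integrableOn_fin_one)
open Summit.KontsevichZagierPeriods.KontsevichZagierPeriods.BetaCancellationNegative
  (volume_setOf_apply_eq_zero)

/-! ## Elements and polynomials of `K = algebraicClosure ℚ ℝ` -/

/-- Elements of the relative algebraic closure of `ℚ` in `ℝ` are real algebraic numbers. [folklore] -/
theorem isAlgebraic_coeK (a : algebraicClosure ℚ ℝ) : IsAlgebraic ℚ (a : ℝ) :=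
  mem_algebraicClosure_iff.mp a.2

/-- Evaluating a `K`-polynomial at an element of `K`, inside `ℝ`. [folklore] -/
theorem aevalK_coe (t : algebraicClosure ℚ ℝ) (G : (algebraicClosure ℚ ℝ)[X]) :
    (Polynomial.aeval (t : ℝ) G : ℝ) = ((Polynomial.aeval t G : algebraicClosure ℚ ℝ) : ℝ) :=
  Polynomial.aeval_algebraMap_apply ℝ t G

/-- The value of a `K`-polynomial at a real algebraic point of `K` is algebraic. [folklore] -/
theorem isAlgebraic_aevalK (t : algebraicClosure ℚ ℝ) (G : (algebraicClosure ℚ ℝ)[X]) :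
    IsAlgebraic ℚ (Polynomial.aeval (t : ℝ) G : ℝ) := by
  rw [aevalK_coe]
  exact isAlgebraic_coeK _

/-- **`K`-polynomials read on the first coordinate are `ℚ`-semialgebraic functions** on any
`ℚ`-semialgebraic `s ⊆ ℝ¹` (each monomial is an algebraic constant times a power of the coordinate).
[cite: BochnakCosteRoy1998, Prop. 2.2.6] -/
theorem isSemialgebraicFunOn_aevalK {s : Set (Fin 1 → ℝ)} (hs : IsSemialgebraic ℚ s)
    (P : (algebraicClosure ℚ ℝ)[X]) :
    IsSemialgebraicFunOn ℚ s (fun x => (Polynomial.aeval (x 0) P : ℝ)) := by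
  induction P using Polynomial.induction_on' with
  | add p q hp hq =>
    exact (IsSemialgebraicFunOn.add_holds hp hq).congr fun x _ => by simp
  | monomial n a =>
    have hpow : IsSemialgebraicFunOn ℚ s (fun x : Fin 1 → ℝ => x 0 ^ n) := by
      simpa using isSemialgebraicFunOn_aeval hs ((MvPolynomial.X 0 : MvPolynomial (Fin 1) ℚ) ^ n)
    exact (IsSemialgebraicFunOn.mul_holds (isSemialgebraicFunOn_const_of_isAlgebraic hs
      (isAlgebraic_coeK a)) hpow).congr fun x _ => by simp [Polynomial.aeval_monomial]

/-- `K`-rational functions `P/Q` (`Q ≠ 0` on `s`) read on the first coordinate are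
`ℚ`-semialgebraic. [cite: BochnakCosteRoy1998, Prop. 2.2.6] -/
theorem isSemialgebraicFunOn_aevalK_div {s : Set (Fin 1 → ℝ)} (hs : IsSemialgebraic ℚ s)
    (P Q : (algebraicClosure ℚ ℝ)[X]) (hQ : ∀ x ∈ s, (Polynomial.aeval (x 0) Q : ℝ) ≠ 0) :
    IsSemialgebraicFunOn ℚ s
      (fun x => (Polynomial.aeval (x 0) P : ℝ) / (Polynomial.aeval (x 0) Q : ℝ)) :=
  (isSemialgebraicFunOn_aevalK hs P).div (isSemialgebraicFunOn_aevalK hs Q) hQ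

/-- The representation `[(0,1), P/Q]` exists for `P, Q ∈ K[X]` with `Q ≠ 0` on `[0,1]`.
[cite: KontsevichZagier2001, §1.1] -/
theorem exists_repK_unit (P Q : (algebraicClosure ℚ ℝ)[X])
    (hQ : ∀ t ∈ Set.Icc (0:ℝ) 1, (Polynomial.aeval t Q : ℝ) ≠ 0) :
    ∃ N : IntegralRep 1, N.domain = {x | x 0 ∈ Set.Ioo (0:ℝ) 1} ∧
      N.integrand = fun x => (Polynomial.aeval (x 0) P : ℝ) / (Polynomial.aeval (x 0) Q : ℝ) := by
  have hdom : IsSemialgebraic ℚ {x : Fin 1 → ℝ | x 0 ∈ Set.Ioo (0:ℝ) 1} := by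
    simpa using isSemialgebraic_Ioo₁ 0 1
  have hsa := isSemialgebraicFunOn_aevalK_div hdom P Q fun x hx => hQ (x 0) (Set.Ioo_subset_Icc_self hx)
  have hint : IntegrableOn (fun x : Fin 1 → ℝ => (Polynomial.aeval (x 0) P : ℝ) /
      (Polynomial.aeval (x 0) Q : ℝ)) {x : Fin 1 → ℝ | x 0 ∈ Set.Ioo (0:ℝ) 1} := by
    rw [integrableOn_fin_one]
    have hc : ContinuousOn (fun t : ℝ => (Polynomial.aeval t P : ℝ) / (Polynomial.aeval t Q : ℝ))
        (Set.Icc (0:ℝ) 1) :=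
      (Polynomial.continuous_aeval P).continuousOn.div (Polynomial.continuous_aeval Q).continuousOn hQ
    exact (hc.integrableOn_compact isCompact_Icc).mono_set Set.Ioo_subset_Icc_self
  exact ⟨⟨_, _, hdom, hsa, hint⟩, rfl, rfl⟩

/-! ## Partial fractions over `K`: one peeling step, and primitives -/

/-- **Peeling a pole over `K`.** If `Q(ρ) = 0` (`ρ ∈ K`, `Q ≠ 0`) then, at every real `t` with
`Q(t) ≠ 0`, `P/Q = c/(t − ρ)^{k+1} + P₁/Q₁` with `k + 1` the multiplicity of `ρ`, `c ∈ K`, and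
`Q₁ ∈ K[X]` a non-zero proper divisor of `Q`. [folklore] -/
theorem peel_pole_algClosure (P Q : (algebraicClosure ℚ ℝ)[X]) (hQ : Q ≠ 0)
    {ρ : algebraicClosure ℚ ℝ} (hρ : Q.IsRoot ρ) :
    ∃ (k : ℕ) (c : algebraicClosure ℚ ℝ) (P₁ Q₁ : (algebraicClosure ℚ ℝ)[X]),
      Q₁ ≠ 0 ∧ Q₁.natDegree < Q.natDegree ∧ Q₁ ∣ Q ∧
      ∀ t : ℝ, (Polynomial.aeval t Q : ℝ) ≠ 0 →
        (Polynomial.aeval t P : ℝ) / (Polynomial.aeval t Q : ℝ) =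
          (c : ℝ) / (t - ρ) ^ (k + 1) + (Polynomial.aeval t P₁ : ℝ) / (Polynomial.aeval t Q₁ : ℝ) := by
  -- adapted from `Dlog.exists_peel_pole` (the same computation over `ℚ`)
  obtain ⟨Q₂, hQ₂, hndvd⟩ := Q.exists_eq_pow_rootMultiplicity_mul_and_not_dvd hQ ρ
  have hm : 0 < Q.rootMultiplicity ρ := (Polynomial.rootMultiplicity_pos hQ).mpr hρ
  obtain ⟨k, hk⟩ : ∃ k, Q.rootMultiplicity ρ = k + 1 := Nat.exists_eq_succ_of_ne_zero hm.ne'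
  have hQ₂ρ : Q₂.eval ρ ≠ 0 := fun h => hndvd (Polynomial.dvd_iff_isRoot.mpr h)
  have hQ₂0 : Q₂ ≠ 0 := by rintro rfl; simp at hQ₂ρ
  set c : algebraicClosure ℚ ℝ := P.eval ρ / Q₂.eval ρ with hc
  have hroot : (P - Polynomial.C c * Q₂).IsRoot ρ := by
    rw [Polynomial.IsRoot.def, Polynomial.eval_sub, Polynomial.eval_mul, Polynomial.eval_C, hc,
      div_mul_cancel₀ _ hQ₂ρ, sub_self]
  set P₁ := (P - Polynomial.C c * Q₂) /ₘ (Polynomial.X - Polynomial.C ρ) with hP₁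
  have hP₁' : (Polynomial.X - Polynomial.C ρ) * P₁ = P - Polynomial.C c * Q₂ :=
    Polynomial.mul_divByMonic_eq_iff_isRoot.mpr hroot
  set Q₁ := (Polynomial.X - Polynomial.C ρ) ^ k * Q₂ with hQ₁
  have hXne : (Polynomial.X - Polynomial.C ρ : (algebraicClosure ℚ ℝ)[X]) ≠ 0 :=
    Polynomial.X_sub_C_ne_zero ρ
  refine ⟨k, c, P₁, Q₁, mul_ne_zero (pow_ne_zero _ hXne) hQ₂0, ?_, ?_, ?_⟩
  · have hdeg : Q.natDegree = (k + 1) + Q₂.natDegree := by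
      conv_lhs => rw [hQ₂, hk]
      rw [Polynomial.natDegree_mul (pow_ne_zero _ hXne) hQ₂0, Polynomial.natDegree_pow,
        Polynomial.natDegree_X_sub_C, mul_one]
    have hdeg₁ : Q₁.natDegree = k + Q₂.natDegree := by
      rw [hQ₁, Polynomial.natDegree_mul (pow_ne_zero _ hXne) hQ₂0, Polynomial.natDegree_pow,
        Polynomial.natDegree_X_sub_C, mul_one]
    omega
  · refine ⟨Polynomial.X - Polynomial.C ρ, ?_⟩
    conv_lhs => rw [hQ₂, hk]
    rw [hQ₁, pow_succ]
    ring
  · intro t ht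
    have hqt : (Polynomial.aeval t Q : ℝ) = (t - ρ) ^ (k + 1) * Polynomial.aeval t Q₂ := by
      conv_lhs => rw [hQ₂, hk]
      simp [map_mul, map_pow]
    have hq₁t : (Polynomial.aeval t Q₁ : ℝ) = (t - ρ) ^ k * Polynomial.aeval t Q₂ := by
      rw [hQ₁]
      simp [map_mul, map_pow]
    have hpt : (Polynomial.aeval t P : ℝ) =
        (t - ρ) * Polynomial.aeval t P₁ + c * Polynomial.aeval t Q₂ := by
      have h := congrArg (Polynomial.aeval t) hP₁'
      simp only [map_mul, map_sub, Polynomial.aeval_X, Polynomial.aeval_C] at h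
      have hcoe : algebraMap (algebraicClosure ℚ ℝ) ℝ c = (c : ℝ) := rfl
      have hcoe' : algebraMap (algebraicClosure ℚ ℝ) ℝ ρ = (ρ : ℝ) := rfl
      rw [hcoe, hcoe'] at h
      linear_combination -h
    have htρ : (t : ℝ) - ρ ≠ 0 := by
      intro h; apply ht; rw [hqt, h]; simp
    have hQ₂t : (Polynomial.aeval t Q₂ : ℝ) ≠ 0 := by
      intro h; apply ht; rw [hqt, h, mul_zero]
    rw [hqt, hq₁t, hpt]
    field_simp
    ring

/-- Every `A ∈ K[X]` has a primitive `G ∈ K[X]` as a real function: `(aeval · G)' = aeval · A`.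
[folklore] -/
theorem exists_polynomial_hasDerivAtK (A : (algebraicClosure ℚ ℝ)[X]) :
    ∃ G : (algebraicClosure ℚ ℝ)[X], ∀ t : ℝ, HasDerivAt (fun u : ℝ => (Polynomial.aeval u G : ℝ))
      (Polynomial.aeval t A) t := by
  -- adapted from `Dlog.exists_polynomial_hasDerivAt` (the same computation over `ℚ`)
  suffices h : ∃ G : (algebraicClosure ℚ ℝ)[X], Polynomial.derivative G = A by
    obtain ⟨G, hG⟩ := h
    refine ⟨G, fun t => ?_⟩
    have := Polynomial.hasDerivAt_aeval G t
    rwa [hG] at this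
  induction A using Polynomial.induction_on' with
  | add p q hp hq =>
    obtain ⟨Gp, hGp⟩ := hp
    obtain ⟨Gq, hGq⟩ := hq
    exact ⟨Gp + Gq, by rw [Polynomial.derivative_add, hGp, hGq]⟩
  | monomial n a =>
    refine ⟨Polynomial.C (a / ((n : algebraicClosure ℚ ℝ) + 1)) * Polynomial.X ^ (n + 1), ?_⟩
    have hn : ((n : algebraicClosure ℚ ℝ) + 1) ≠ 0 := by exact_mod_cast Nat.succ_ne_zero n
    rw [Polynomial.derivative_C_mul_X_pow, ← Polynomial.C_mul_X_pow_eq_monomial, Nat.add_sub_cancel]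
    congr 2
    push_cast
    exact div_mul_cancel₀ a hn

/-! ## The Newton–Leibniz move over the point on the unit slab -/

/-- **Newton–Leibniz over the point (registered sub-goal of the siege)** — rule (3) over the base
`ℝ⁰`, then rule (1a) across the two null endpoints. Let `N = [(0,1), f]` be an interval
representation whose integrand `x ↦ f(x₀)` is `ℚ`-semialgebraic on the closed slab, and `F` a
primitive of `f` on `(0,1)`, continuous on `[0,1]` and `ℚ`-semialgebraic (read on the first
coordinate) on the closed slab. Then `[N] − [pt, F(1) − F(0)] ∈ KZ.relations` for every point
representation with that constant. [cite: KontsevichZagier2001, §1.2 rule (3)] -/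
theorem unit_slab_sub_pt_mem_relations (f F : ℝ → ℝ)
    (hF : IsSemialgebraicFunOn ℚ {x : Fin 1 → ℝ | x 0 ∈ Set.Icc (0:ℝ) 1} (fun x => F (x 0)))
    (hf : IsSemialgebraicFunOn ℚ {x : Fin 1 → ℝ | x 0 ∈ Set.Icc (0:ℝ) 1} (fun x => f (x 0)))
    (hcont : ContinuousOn F (Set.Icc (0:ℝ) 1))
    (hderiv : ∀ t ∈ Set.Ioo (0:ℝ) 1, HasDerivAt F (f t) t)
    (N : IntegralRep 1) (hNd : N.domain = {x | x 0 ∈ Set.Ioo (0:ℝ) 1})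
    (hNi : EqOn N.integrand (fun x => f (x 0)) N.domain)
    (Z : IntegralRep 0) (hZd : Z.domain = Set.univ) (hZi : Z.integrand = fun _ => F 1 - F 0) :
    of N - of Z ∈ relations := by
  -- adapted from `Dlog.slab_sub_pt_mem_relations` (rational primitive) to an abstract primitive
  have hCsa : IsSemialgebraic ℚ {x : Fin 1 → ℝ | x 0 ∈ Set.Icc (0:ℝ) 1} := by
    simpa using isSemialgebraic_Icc₁ 0 1
  have hOsa : IsSemialgebraic ℚ {x : Fin 1 → ℝ | x 0 ∈ Set.Ioo (0:ℝ) 1} := by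
    simpa using isSemialgebraic_Ioo₁ 0 1
  set C : Set (Fin 1 → ℝ) := {x | x 0 ∈ Set.Icc (0:ℝ) 1} with hC
  -- the integrand `f` on the closed slab is integrable (it is `N.integrand` a.e.)
  have hfi : IntegrableOn (fun x : Fin 1 → ℝ => f (x 0)) C := by
    have h1 : IntegrableOn (fun x : Fin 1 → ℝ => f (x 0)) N.domain :=
      N.integrableOn.congr_fun hNi (IsSemialgebraic.measurableSet_holds N.isSemialgebraic_domain)
    rw [hNd, integrableOn_fin_one] at h1
    rw [hC, integrableOn_fin_one]
    exact h1.congr_set_ae (Ioo_ae_eq_Icc (a := (0:ℝ)) (b := 1)).symm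
  -- the closed-slab representation `R = [[0,1], f]`
  obtain ⟨R, hRd, hRi⟩ : ∃ R : IntegralRep 1, R.domain = C ∧ R.integrand = fun x => f (x 0) :=
    ⟨⟨C, fun x => f (x 0), hCsa, hf, hfi⟩, rfl, rfl⟩
  have hs0 : ∀ (x : Fin 0 → ℝ) (t : ℝ), (Fin.snoc x t : Fin 1 → ℝ) 0 = t := fun _ _ => rfl
  -- (i) ONE Newton–Leibniz move over `ℝ⁰`: `[R] − [Z] ∈ newtonLeibnizRel`, primitive `F (z 0)`
  have hNL : of R - of Z ∈ newtonLeibnizRel := by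
    refine ⟨0, R, Z, fun _ => (0:ℝ), fun _ => (1:ℝ), fun z => F (z 0), ?_, ?_, ?_,
      fun _ _ => zero_le_one, ?_, ?_, ?_, ?_, rfl⟩
    · rw [hRd]; exact hF
    · rw [hZd]
      simpa using isSemialgebraicFunOn_aeval (isSemialgebraic_univ (k := ℚ) (ι := Fin 0) (R := ℝ))
        (MvPolynomial.C 0)
    · rw [hZd]
      simpa using isSemialgebraicFunOn_aeval (isSemialgebraic_univ (k := ℚ) (ι := Fin 0) (R := ℝ))
        (MvPolynomial.C 1)
    · rw [hRd, hZd, hC]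
      ext z
      simp only [Set.mem_setOf_eq, Set.mem_Icc, Set.mem_univ, true_and]
      rfl
    · intro x _
      simp only [hs0]
      exact hcont
    · intro x _ t ht
      rw [hRi]
      simp only [hs0]
      exact hderiv t ht
    · intro x _
      simp only [hZi, hs0]
  -- (ii) closed slab versus the open slab `N.domain` (null endpoints), and congruence with `N`
  have hEsub : {x : Fin 1 → ℝ | x 0 ∈ Set.Ioo (0:ℝ) 1} ⊆ R.domain := by
    rw [hRd, hC]
    exact fun x hx => Set.Ioo_subset_Icc_self hx
  have hnull : volume (R.domain \ {x : Fin 1 → ℝ | x 0 ∈ Set.Ioo (0:ℝ) 1}) = 0 := by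
    refine measure_mono_null (fun x hx => ?_)
      (measure_union_null (volume_setOf_apply_eq_zero (0 : Fin 1) (0:ℝ))
        (volume_setOf_apply_eq_zero (0 : Fin 1) (1:ℝ)))
    rw [hRd, hC] at hx
    obtain ⟨⟨h1, h2⟩, h3⟩ := hx
    simp only [Set.mem_setOf_eq, Set.mem_Ioo, not_and, not_lt] at h3
    simp only [Set.mem_union, Set.mem_setOf_eq]
    rcases h1.lt_or_eq with h1 | h1
    · exact Or.inr (le_antisymm h2 (h3 h1))
    · exact Or.inl h1.symm
  have h2 : of R - of (R.restrict _ hOsa hEsub) ∈ relations :=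
    R.of_sub_of_restrict_mem_relations hOsa hEsub hnull
  have h3 : of (R.restrict _ hOsa hEsub) - of N ∈ relations :=
    of_sub_of_mem_relations_of_eqOn (by rw [hNd]; rfl) fun x hx => by
      rw [IntegralRep.integrand_restrict, hRi, hNi (by rw [hNd]; exact hx)]
  have : of N - of Z = (of R - of Z) - (of R - of (R.restrict _ hOsa hEsub)) -
      (of (R.restrict _ hOsa hEsub) - of N) := by abel
  rw [this]
  exact relations.sub_mem (relations.sub_mem (newtonLeibnizRel_subset_relations hNL) h2) h3

/-! ## Affine moves with real algebraic coefficients; simple poles to carriers -/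

/-- **Affine move with algebraic coefficients** (rule 2), either orientation: if
`Φ(x) = s x + t` (`s ≠ 0`; `s, t` real algebraic) maps the slab `N.domain` onto `L.domain` and
`N`'s integrand is the pull-back `f(Φ x)·|s|` of `L`'s integrand `f`, then `[N] − [L] ∈ relations`.
[cite: KontsevichZagier2001, §1.2 rule (2)] -/
theorem affineA_sub_mem_relations {s t : ℝ} (hsalg : IsAlgebraic ℚ s) (htalg : IsAlgebraic ℚ t)
    (hs : s ≠ 0) (N L : IntegralRep 1) (f : ℝ → ℝ)
    (himage : L.domain = (fun y : Fin 1 → ℝ => fun _ : Fin 1 => s * y 0 + t) '' N.domain)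
    (hLi : EqOn L.integrand (fun x => f (x 0)) L.domain)
    (hNi : EqOn N.integrand (fun x => f (s * x 0 + t) * |s|) N.domain) :
    of N - of L ∈ relations := by
  -- adapted from `Dlog.affine_sub_mem_relations` (rational coefficients)
  have hdet : |(s • ContinuousLinearMap.id ℝ (Fin 1 → ℝ)).det| = |s| := by
    have : (s • ContinuousLinearMap.id ℝ (Fin 1 → ℝ)).det = s := by
      change LinearMap.det ((s • ContinuousLinearMap.id ℝ (Fin 1 → ℝ) :
        (Fin 1 → ℝ) →L[ℝ] (Fin 1 → ℝ)) : (Fin 1 → ℝ) →ₗ[ℝ] (Fin 1 → ℝ)) = s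
      rw [ContinuousLinearMap.toLinearMap_smul, ContinuousLinearMap.coe_id,
        LinearMap.det_smul, LinearMap.det_id, Module.finrank_fin_fun]
      ring
    rw [this]
  refine changeOfVariablesRel_subset_relations
    ⟨1, N, L, fun y : Fin 1 → ℝ => fun _ : Fin 1 => s * y 0 + t,
      fun _ => s • ContinuousLinearMap.id ℝ (Fin 1 → ℝ),
      aff_isSemialgebraicMapOn_chart N.isSemialgebraic_domain htalg hsalg,
      fun x _ => (aff_hasFDerivAt_chart s t x).hasFDerivWithinAt,
      (aff_injective_chart hs t).injOn, himage, fun x hx => ?_, rfl⟩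
  have hΦx : (fun _ : Fin 1 => s * x 0 + t) ∈ L.domain := himage ▸ Set.mem_image_of_mem _ hx
  rw [hNi hx, hLi hΦx, hdet]

/-- **A simple pole to the left of `[0,1]` is a carrier**: for real algebraic `ρ < 0` and
algebraic `c`, the substitution `y = (x − ρ)/(−ρ)` carries `[(0,1), c/(x − ρ)]` to
`[(1, 1 − 1/ρ), c/y]` (one rule-(2) move). [cite: KontsevichZagier2001, §1.2 rule (2)] -/
theorem pole_neg_sub_carrier_mem_relations {ρ c : ℝ} (hρalg : IsAlgebraic ℚ ρ) (hρ : ρ < 0)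
    (N L : IntegralRep 1) (hNd : N.domain = {x | x 0 ∈ Set.Ioo (0:ℝ) 1})
    (hNi : EqOn N.integrand (fun x => c / (x 0 - ρ)) N.domain)
    (hLd : L.domain = {x | x 0 ∈ Set.Ioo (1:ℝ) (1 - 1 / ρ)})
    (hLi : L.integrand = fun x => c / x 0) : of N - of L ∈ relations := by
  have hs : 0 < -1 / ρ := div_pos_of_neg_of_neg (by norm_num) hρ
  refine affineA_sub_mem_relations (s := -1 / ρ) (t := 1)
    (by rw [neg_div, one_div]; exact hρalg.inv.neg)
    isAlgebraic_one hs.ne' N L (fun y => c / y) ?_ (by rw [hLi]; exact fun _ _ => rfl) fun x hx => ?_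
  · rw [hNd, image_affine_slab_of_pos hs, hLd]
    congr 1
    ext x
    have : -1 / ρ * 1 + 1 = 1 - 1 / ρ := by ring
    rw [mul_zero, zero_add, this]
  · rw [hNi hx, abs_of_pos hs]
    have hx0 : x 0 - ρ ≠ 0 := by rw [hNd] at hx; linarith [hx.1]
    have hρ0 : ρ ≠ 0 := hρ.ne
    have hΦ : -1 / ρ * x 0 + 1 = (x 0 - ρ) * (-1 / ρ) := by field_simp; ring
    show c / (x 0 - ρ) = c / (-1 / ρ * x 0 + 1) * (-1 / ρ)
    rw [hΦ, div_mul_eq_div_div, div_mul_cancel₀ _ hs.ne']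

/-- **A simple pole to the right of `[0,1]` is a carrier**: for real algebraic `ρ > 1` and
algebraic `c`, the (orientation-reversing) substitution `y = (x − ρ)/(1 − ρ)` carries
`[(0,1), c/(x − ρ)]` to `[(1, ρ/(ρ − 1)), (−c)/y]` (one rule-(2) move).
[cite: KontsevichZagier2001, §1.2 rule (2)] -/
theorem pole_pos_sub_carrier_mem_relations {ρ c : ℝ} (hρalg : IsAlgebraic ℚ ρ) (hρ : 1 < ρ)
    (N L : IntegralRep 1) (hNd : N.domain = {x | x 0 ∈ Set.Ioo (0:ℝ) 1})
    (hNi : EqOn N.integrand (fun x => c / (x 0 - ρ)) N.domain)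
    (hLd : L.domain = {x | x 0 ∈ Set.Ioo (1:ℝ) (ρ / (ρ - 1))})
    (hLi : L.integrand = fun x => (-c) / x 0) : of N - of L ∈ relations := by
  have hρ1 : ρ - 1 ≠ 0 := by linarith
  have hρ1' : 1 - ρ ≠ 0 := by linarith
  have hs : 1 / (1 - ρ) < 0 := div_neg_of_pos_of_neg one_pos (by linarith)
  refine affineA_sub_mem_relations (s := 1 / (1 - ρ)) (t := -ρ / (1 - ρ))
    (by rw [one_div]; exact (isAlgebraic_one.sub hρalg).inv)
    (by rw [neg_div, div_eq_mul_inv]; exact (hρalg.mul (isAlgebraic_one.sub hρalg).inv).neg) hs.ne N L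
    (fun y => (-c) / y) ?_ (by rw [hLi]; exact fun _ _ => rfl) fun x hx => ?_
  · rw [hNd, image_affine_slab_of_neg hs, hLd]
    congr 1
    ext x
    have h1 : 1 / (1 - ρ) * 1 + -ρ / (1 - ρ) = 1 := by field_simp; ring
    have h2 : 1 / (1 - ρ) * 0 + -ρ / (1 - ρ) = ρ / (ρ - 1) := by
      rw [mul_zero, zero_add, neg_div, ← div_neg, neg_sub]
    rw [h1, h2]
  · rw [hNi hx, abs_of_neg hs]
    have hx0 : x 0 - ρ ≠ 0 := by rw [hNd] at hx; linarith [hx.2]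
    have hΦ : 1 / (1 - ρ) * x 0 + -ρ / (1 - ρ) = (x 0 - ρ) * (1 / (1 - ρ)) := by field_simp; ring
    show c / (x 0 - ρ) = (-c) / (1 / (1 - ρ) * x 0 + -ρ / (1 - ρ)) * -(1 / (1 - ρ))
    rw [hΦ, div_mul_eq_div_div, neg_div, mul_neg, neg_div, neg_mul, neg_neg, div_mul_cancel₀ _ hs.ne]

end AlgSplitK5

end Summit.KontsevichZagierPeriods.HurwitzMicroSectors.NormalFormPrinciple.PiBox
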